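import Summits.QuantumFields.GaugeBoot.TiltedBoxRedSiteGeometry
import HarnessLib

/-!
# The reduced half of the site mirror of the even square tilted box in general dimension: the witness (gauge-boot, L3 supplement: reduced-half in-plane mirrors, 3b/7)

HONEST FRAMING (cell `pub-gaugeboot`, page 1 of every file): the venture produces certified bounds
on lattice expectations at stated coupling, gauge group, dimension and torus size; NOT a mass gap,
NOT a continuum limit, NOT a string tension; NOT Yang–Mills-summit-bearing (barriers
`FixedCouplingUltralocality`, `PerturbativeInvisibility`). This module is bookkeeping for a small
structural NEGATIVE result (the REDUCED-half in-plane mirrors of the square tilted boxes are not of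
positive type in `d ≥ 3` at small coupling); it discharges nothing by itself.

## Content (even box `ℤ^d/Γ(2P, 2P, L)`, `P ≥ 2`, site mirror `Θ_i : x_i ↦ -x_i`, any `d`)

Continuation of `TiltedBoxRedSiteGeometry.lean` (weights `redW`, rest set `restSet`, half-weighted
action `redExpoG` with `E(ΘU) + E(U) - S(U) = -∑_{rest} (N - Re tr ρ(U_q))`):

* THE WITNESS `redF = (W_v - W_{v+T}) · e^{β E}` with `v = (y₋; q)` a TRANSVERSE plaquette
  (`q = (q₁, q₂)`, `q₁, q₂ ≠ i` — this is where `d ≥ 3` enters) of the top layer `y₋ = [(P-1)e_i]`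
  of the reduced half and `T = [2P e_j]` the half period: continuous, bounded, measurable, and an
  observable of the reduced half (`redF_eq_of_redSiteLinks`, links `TwoDim.IsRedSiteLink`);
* ★ **`redDiff_configReflect`** — by the twist lemma `Θ_i y₋ = y₋ + 2e_i + T`
  (`TwoDim.tiltedAxisFlip_of_axisCoord_eq_pred`),
  `(W_v - W_{v+T}) ∘ Θ_i = W_{v + 2e_i + T} - W_{v + 2e_i}`: the mirror image of `v` sits above
  `v + T`, NOT above `v`;
* ★ **`boltzmann_redF`** — the half-action trick:
  `e^{-β S(U)} conj F(ΘU) F(U) = e^{-β N |rest|} · D(ΘU) D(U) · ∏_{rest} e^{β Re tr ρ(U_q)}`.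

Elementary; mechanism folklore (as in `TiltedBoxOddAxisWitness.lean`).
-/

noncomputable section

open QuotientAddGroup Finset Function MeasureTheory
open scoped ComplexConjugate

namespace Summit.QuantumFields.GaugeBoot

namespace TiltedRP

namespace RedSite

variable {d : ℕ} {i j : Fin d} {L P N : ℕ} [NeZero L] [NeZero P]
variable {G : Type*} [Group G]
variable (ρ : G →* Matrix (Fin N) (Fin N) ℂ)

/-! ## The witness -/

variable (q : DirPair d)

/-- The observable `W_x = Re tr ρ(U_{(x; q)})` of the transverse plaquette `q` based at `x`. [folklore] -/
def rW (x : TiltedSite d i j (2 * P) (2 * P) L) (U : Config (TiltedSite d i j (2 * P) (2 * P) L) d G) : ℝ :=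
  plaqObs ρ (tiltedUnit d i j (2 * P) (2 * P) L) (x, q) U

/-- The difference `W_{y₋} - W_{y₋ + T}` on the top layer `y₋ = [(P-1)e_i]` of the reduced half. [folklore] -/
def redDiff (U : Config (TiltedSite d i j (2 * P) (2 * P) L) d G) : ℝ :=
  rW ρ q (TwoDim.predLayerSite d L P) U - rW ρ q (TwoDim.predLayerSite d L P + tiltedTwist d L (2 * P)) U

/-- **The witness** `F = (W_{y₋} - W_{y₋+T}) · exp(β E)`. [folklore] -/
def redF (β : ℝ) (U : Config (TiltedSite d i j (2 * P) (2 * P) L) d G) : ℂ :=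
  ((redDiff ρ q U : ℝ) : ℂ) * ((Real.exp (β * redExpoG ρ U) : ℝ) : ℂ)

section Regularity

variable [TopologicalSpace G] [IsTopologicalGroup G]

omit [NeZero L] [NeZero P] in
/-- `W_x` is continuous. [folklore] -/
theorem continuous_rW (hρ : Continuous ρ) (x : TiltedSite d i j (2 * P) (2 * P) L) :
    Continuous fun U : Config (TiltedSite d i j (2 * P) (2 * P) L) d G => rW ρ q x U :=
  continuous_plaqObs ρ hρ _ _

omit [NeZero L] [NeZero P] in
/-- `redDiff` is continuous. [folklore] -/
theorem continuous_redDiff (hρ : Continuous ρ) :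
    Continuous fun U : Config (TiltedSite d i j (2 * P) (2 * P) L) d G => redDiff ρ q U :=
  (continuous_rW ρ q hρ _).sub (continuous_rW ρ q hρ _)

/-- `F` is continuous. [folklore] -/
theorem continuous_redF (hρ : Continuous ρ) (β : ℝ) :
    Continuous fun U : Config (TiltedSite d i j (2 * P) (2 * P) L) d G => redF ρ q β U :=
  (Complex.continuous_ofReal.comp (continuous_redDiff ρ q hρ)).mul
    (Complex.continuous_ofReal.comp (Real.continuous_exp.comp (continuous_const.mul (continuous_redExpoG ρ hρ))))

/-- `F` is measurable. [folklore] -/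
theorem measurable_redF [MeasurableSpace G] [BorelSpace G] [SecondCountableTopology G] (hρ : Continuous ρ) (β : ℝ) :
    Measurable fun U : Config (TiltedSite d i j (2 * P) (2 * P) L) d G => redF ρ q β U :=
  (continuous_redF ρ q hρ β).measurable

/-- `F` is bounded (continuous on the compact configuration space). [folklore] -/
theorem exists_norm_redF_le [CompactSpace G] (hρ : Continuous ρ) (β : ℝ) :
    ∃ C : ℝ, ∀ U : Config (TiltedSite d i j (2 * P) (2 * P) L) d G, ‖redF ρ q β U‖ ≤ C := by
  obtain ⟨C, hC⟩ := isBounded_iff_forall_norm_le.1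
    (isCompact_range (continuous_redF (i := i) (j := j) (L := L) (P := P) ρ q hρ β)).isBounded
  exact ⟨C, fun U => hC _ ⟨U, rfl⟩⟩

end Regularity

/-! ## The witness is an observable of the reduced half -/

omit [NeZero L] [NeZero P] in
/-- A transverse plaquette of the layer `P - 1` has weight `1`. [folklore] -/
theorem redW_transverse_pred (hP : 2 ≤ P) (x : TiltedSite d i j (2 * P) (2 * P) L) (hq1 : q.1.1 ≠ i) (hq2 : q.1.2 ≠ i)
    (hx : axisCoord d L (2 * P) x = ((P : ℕ) : ZMod (2 * P)) - 1) :
    redW ((x, q) : Plaq (TiltedSite d i j (2 * P) (2 * P) L) d) = 1 := by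
  have hval : (axisCoord d L (2 * P) x).val = P - 1 := by rw [hx, TwoDim.val_natCast_sub_one hP]
  have hx0 : axisCoord d L (2 * P) x ≠ 0 := fun h => by
    rw [h, ZMod.val_zero] at hval; omega
  unfold redW wT
  simp only [hq1, hq2, or_self, if_false, hx0, hval]
  rw [if_pos (by omega)]

/-- **The witness is an observable of the reduced half `{0 ≤ x_i ≤ P - 1}`.** [folklore] -/
theorem redF_eq_of_redSiteLinks (hP : 2 ≤ P) (hij : i ≠ j) (hq1 : q.1.1 ≠ i) (hq2 : q.1.2 ≠ i) (β : ℝ)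
    (U V : Config (TiltedSite d i j (2 * P) (2 * P) L) d G)
    (hUV : ∀ l, TwoDim.IsRedSiteLink (P := P) l → U l = V l) : redF ρ q β U = redF ρ q β V := by
  have hW : ∀ x, axisCoord d L (2 * P) x = ((P : ℕ) : ZMod (2 * P)) - 1 → rW ρ q x U = rW ρ q x V := by
    intro x hx
    exact plaqObs_eq_of_redW_ne_zero ρ hP hUV (by rw [redW_transverse_pred q hP x hq1 hq2 hx]; norm_num)
  have hD : redDiff ρ q U = redDiff ρ q V := by
    unfold redDiff
    rw [hW _ TwoDim.axisCoord_predLayerSite, hW _ (by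
      rw [map_add, TwoDim.axisCoord_predLayerSite, axisCoord_tiltedTwist d L _ hij, add_zero])]
  unfold redF
  rw [hD, redExpoG_eq_of_redSiteLinks ρ hP hUV]

/-! ## The reflected difference -/

omit [NeZero L] [NeZero P] in
/-- **The twist lemma on the witness**: `(W_{y₋} - W_{y₋+T})(Θ_i U) = W_{y₋ + 2e_i + T}(U) - W_{y₋ + 2e_i}(U)`
— the mirror image of the plaquette at `y₋` sits above `y₋ + T`, that of `y₋ + T` above `y₋`. [folklore] -/
theorem redDiff_configReflect [TopologicalSpace G] [IsTopologicalGroup G] [CompactSpace G]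
    (hij : i ≠ j) (hq1 : q.1.1 ≠ i) (hq2 : q.1.2 ≠ i) (hρ : Continuous ρ)
    (U : Config (TiltedSite d i j (2 * P) (2 * P) L) d G) :
    redDiff ρ q (configReflect (tiltedUnit d i j (2 * P) (2 * P) L) i (tiltedAxisFlip d L (2 * P) hij) U) =
      rW ρ q (TwoDim.predLayerSite d L P + tiltedUnit d i j (2 * P) (2 * P) L i +
          tiltedUnit d i j (2 * P) (2 * P) L i + tiltedTwist d L (2 * P)) U -
      rW ρ q (TwoDim.predLayerSite d L P + tiltedUnit d i j (2 * P) (2 * P) L i +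
          tiltedUnit d i j (2 * P) (2 * P) L i) U := by
  have hF : IsAxisFlip (tiltedUnit d i j (2 * P) (2 * P) L) i (tiltedAxisFlip d L (2 * P) hij) :=
    isAxisFlip_tiltedAxisFlip d L (2 * P) hij
  have hnot : ∀ x : TiltedSite d i j (2 * P) (2 * P) L,
      ¬ HasDir ((x, q) : Plaq (TiltedSite d i j (2 * P) (2 * P) L) d) i := fun x h => h.elim hq1 hq2
  have hrefl : ∀ x : TiltedSite d i j (2 * P) (2 * P) L,
      IsSiteFrame.plaqReflect (tiltedUnit d i j (2 * P) (2 * P) L) i (tiltedAxisFlip d L (2 * P) hij) (x, q) =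
        (tiltedAxisFlip d L (2 * P) hij x, q) := fun x =>
    Prod.ext (IsSiteFrame.plaqReflect_fst_of_not_hasDir (hnot x)) (IsSiteFrame.plaqReflect_snd _)
  have h0 : tiltedAxisFlip d L (2 * P) hij (TwoDim.predLayerSite d L P) =
      TwoDim.predLayerSite d L P + tiltedUnit d i j (2 * P) (2 * P) L i + tiltedUnit d i j (2 * P) (2 * P) L i +
        tiltedTwist d L (2 * P) :=
    TwoDim.tiltedAxisFlip_of_axisCoord_eq_pred hij _ TwoDim.axisCoord_predLayerSite
  have hT : tiltedAxisFlip d L (2 * P) hij (TwoDim.predLayerSite d L P + tiltedTwist d L (2 * P)) =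
      TwoDim.predLayerSite d L P + tiltedUnit d i j (2 * P) (2 * P) L i + tiltedUnit d i j (2 * P) (2 * P) L i := by
    rw [map_add, tiltedAxisFlip_tiltedTwist, h0, add_assoc _ (tiltedTwist d L (2 * P)),
      tiltedTwist_add_tiltedTwist d L _ hij, add_zero]
  unfold redDiff rW
  rw [hF.plaqObs_configReflect ρ hρ, hF.plaqObs_configReflect ρ hρ, hrefl, hrefl, h0, hT]

/-! ## The Boltzmann weight against the witness pair -/

/-- **The half-action trick on the witness**: for every configuration,
`e^{-β S(U)} · conj F(ΘU) · F(U) = e^{-β N |rest|} · D(ΘU) · D(U) · ∏_{q ∈ rest} e^{β Re tr ρ(U_q)}`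
with `D = W_{y₋} - W_{y₋+T}` (real), as a complex number. [folklore] -/
theorem boltzmann_redF [TopologicalSpace G] [IsTopologicalGroup G] [CompactSpace G]
    (hP : 2 ≤ P) (hij : i ≠ j) (hρ : Continuous ρ) (β : ℝ)
    (U : Config (TiltedSite d i j (2 * P) (2 * P) L) d G) :
    ((Real.exp (-β * wilsonAction ρ (tiltedUnit d i j (2 * P) (2 * P) L) U) : ℝ) : ℂ) *
        (conj (redF ρ q β (configReflect (tiltedUnit d i j (2 * P) (2 * P) L) i (tiltedAxisFlip d L (2 * P) hij) U)) *
          redF ρ q β U) =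
      (((Real.exp (-(β * N * (restSet d i j L P).card)) *
          (redDiff ρ q (configReflect (tiltedUnit d i j (2 * P) (2 * P) L) i (tiltedAxisFlip d L (2 * P) hij) U) *
            redDiff ρ q U *
            ∏ p ∈ restSet d i j L P, Real.exp (β * plaqObs ρ (tiltedUnit d i j (2 * P) (2 * P) L) p U))) : ℝ) : ℂ) := by
  set Θ := configReflect (G := G) (tiltedUnit d i j (2 * P) (2 * P) L) i (tiltedAxisFlip d L (2 * P) hij) with hΘ
  have hE := redExpoG_configReflect_add ρ hP hij hρ U
  -- everything is real
  have hreal : conj (redF ρ q β (Θ U)) = redF ρ q β (Θ U) := by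
    unfold redF; rw [map_mul, Complex.conj_ofReal, Complex.conj_ofReal]
  rw [hreal]
  unfold redF
  have hexp : Real.exp (-β * wilsonAction ρ (tiltedUnit d i j (2 * P) (2 * P) L) U) *
      (Real.exp (β * redExpoG ρ (Θ U)) * Real.exp (β * redExpoG ρ U)) =
      Real.exp (-(β * N * (restSet d i j L P).card)) *
        ∏ p ∈ restSet d i j L P, Real.exp (β * plaqObs ρ (tiltedUnit d i j (2 * P) (2 * P) L) p U) := by
    rw [← Real.exp_add, ← Real.exp_add, ← Real.exp_sum, ← Real.exp_add]
    congr 1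
    have : -β * wilsonAction ρ (tiltedUnit d i j (2 * P) (2 * P) L) U + (β * redExpoG ρ (Θ U) + β * redExpoG ρ U) =
        β * (redExpoG ρ (Θ U) + redExpoG ρ U - wilsonAction ρ (tiltedUnit d i j (2 * P) (2 * P) L) U) := by ring
    rw [this, hE]
    simp only [mul_neg, Finset.mul_sum, mul_sub, Finset.sum_sub_distrib, Finset.sum_const, nsmul_eq_mul]
    ring
  have hexpR : Real.exp (-(β * N * (restSet d i j L P).card)) *
      (redDiff ρ q (Θ U) * redDiff ρ q U *
        ∏ p ∈ restSet d i j L P, Real.exp (β * plaqObs ρ (tiltedUnit d i j (2 * P) (2 * P) L) p U)) =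
      Real.exp (-β * wilsonAction ρ (tiltedUnit d i j (2 * P) (2 * P) L) U) *
        (Real.exp (β * redExpoG ρ (Θ U)) * Real.exp (β * redExpoG ρ U)) * (redDiff ρ q (Θ U) * redDiff ρ q U) := by
    rw [hexp]; ring
  rw [hexpR]
  push_cast
  ring

end RedSite

end TiltedRP

end Summit.QuantumFields.GaugeBoot

end
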